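import Mathlib
import Summits.Ventures.PercRepro2.Defs
import Summits.Ventures.PercRepro2.Independence
import Summits.Ventures.PercRepro2.Harris
import Summits.Ventures.PercRepro2.Graph
import Summits.Ventures.PercRepro2.Exploration
import Summits.Ventures.PercRepro2.Events
import Summits.Ventures.PercRepro2.FourFunctions
import Summits.Ventures.PercRepro2.Induced
import Summits.Ventures.PercRepro2.Frontier
import Summits.Ventures.PercRepro2.ObsIndependence
import Summits.Ventures.PercRepro2.BHK
import Summits.Ventures.PercRepro2.BHKEvents
import Summits.Ventures.PercRepro2.MultiSource
import Summits.Ventures.PercRepro2.OrderPreservation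
import Summits.Ventures.PercRepro2.SeedSet
import Summits.Ventures.PercRepro2.MultiSourceFun
import Summits.Ventures.PercRepro2.CrossRootT
import Summits.Ventures.PercRepro2.VdBKahn
import Summits.Ventures.PercRepro2.LemmaA
import Summits.Ventures.PercRepro2.GateDefs
import Summits.Ventures.PercRepro2.GateFrame

/-!
# The S-frame of the dual marker gate: event identities and the S-frame BHK step
(blind cell PercRepro2, typer-1; the lemmas behind THEOREM (DUAL MARKER GATE), mine-c g6 MINE-C.md
§13.10 — split off `GateDual.lean` (≤ 400-line files))

Root `s`, avoided `T`, gate set `A`, markers `a, b`, `K = hull(T)`.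

* Event identities: `{b ∈ K}` (`hitsK_singleton`), `Y ∩ R_T ⊆ {K avoids b}` (`Y_inter_avoid_subset`:
  on `R_T` the clusters `S` and `K` are disjoint), `R_{T ∪ A} = R_T ∩ {S avoids A}`,
  `{S hits A} = {S avoids A}ᶜ`, `avoidAllT {s} X = avoidAll s X`;
* `kappa W = P(b ↔ T in G − W)` (`delClusterProb` of `b` for the up-set `{S' | S' meets T}`),
  antitone and `≤ 1`; the S-frame tower identity `sframe_tower`
  (`prob_clusterSetIn_inter_eq_expect` with seed `{s}` and vertex `b`);
* **`sframe_step`**: given `R₁ = R_{T ∪ A ∪ {b}}`, `X = {a ∈ S}` and `{b ∈ K}` are negatively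
  correlated, `P(X, b ∈ K; R₁) P(R₁) ≤ P(X; R₁) P(b ∈ K; R₁)` — explore `S = C(s)`: given `S = W` the
  marker event is `1[a ∈ W]` (increasing) and `{b ∈ K}` has probability `κ_b(W)` (decreasing), so
  the seed-set BHK `bhk_multi` with seed `{s}` and avoided set `T ∪ A ∪ {b}` applies (mine-c's
  warning: the naive `E[X | b ∈ K, S avoids A] ≤ E[X | b ∈ K]` is FALSE — the proof must go through
  the S-frame).
-/

namespace Summit.Ventures.PercRepro2

namespace Gate

open scoped Classical

variable {V : Type*} {E : Type*} [Fintype E] [DecidableEq E] [Fintype V] [DecidableEq V]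
  {R : Type*} [Field R] [LinearOrder R] [IsStrictOrderedRing R]

/-! ## Event identities -/

section Events

variable (ends : E → Sym2 V) (s : V) (T A : Finset V) (a b : V)

omit [Fintype E] [DecidableEq E] [Fintype V] [DecidableEq V] in
/-- `{b ∈ K}` (the hull of `T` hits `{b}`). -/
lemma hitsK_singleton : hitsK ends T {b} = {ω | ∃ t ∈ T, Conn ends ω t b} := by
  ext ω; simp [hitsK]

omit [Fintype E] [DecidableEq E] [Fintype V] [DecidableEq V] in
/-- On `R_T`, `b ∈ C(s)` excludes `b ∈ K`: `Y ∩ R ⊆ {K avoids b}`. -/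
lemma Y_inter_avoid_subset :
    connAll ends s {b} ∩ avoidAll ends s T ⊆ (hitsK ends T {b})ᶜ := by
  rintro ω ⟨hY, hR⟩ ⟨w, hw, t, ht, hc⟩
  rw [Finset.mem_singleton] at hw
  subst hw
  have hb : Conn ends ω s w := by
    simpa [connAll] using hY
  exact hR t ht (conn_trans hb (conn_symm hc))

omit [Fintype E] [DecidableEq E] [Fintype V] in
/-- `R_{T ∪ A} = R_T ∩ {S avoids A}`. -/
lemma avoidAll_union_eq : avoidAll ends s (T ∪ A) = avoidAll ends s T ∩ avoidAll ends s A := by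
  ext ω
  simp only [avoidAll, Set.mem_setOf_eq, Set.mem_inter_iff, Finset.mem_union]
  constructor
  · intro h; exact ⟨fun t ht => h t (Or.inl ht), fun u hu => h u (Or.inr hu)⟩
  · rintro ⟨h1, h2⟩ v hv
    rcases hv with hv | hv
    · exact h1 v hv
    · exact h2 v hv

omit [Fintype E] [DecidableEq E] [Fintype V] [DecidableEq V] in
/-- `{S hits A} = {S avoids A}ᶜ`. -/
lemma hitsS_eq_compl : hitsS ends s A = (avoidAll ends s A)ᶜ := by
  ext ω
  simp only [hitsS, avoidAll, Set.mem_setOf_eq, Set.mem_compl_iff, not_forall, not_not]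
  constructor
  · rintro ⟨u, hu, hc⟩; exact ⟨u, hu, hc⟩
  · rintro ⟨u, hu, hc⟩; exact ⟨u, hu, hc⟩

omit [Fintype E] [DecidableEq E] [Fintype V] [DecidableEq V] in
/-- `avoidAllT {s} X = avoidAll s X`. -/
lemma avoidAllT_seed_singleton (X : Finset V) : avoidAllT ends {s} X = avoidAll ends s X := by
  ext ω
  simp [avoidAllT, avoidAll]

end Events

/-! ## The S-frame step -/

section SFrame

variable (p : E → R) (ends : E → Sym2 V) (s : V) (T A : Finset V) (a b : V)

/-- `κ_b(W) = P(b ↔ T in G − W)`: the probability that the cluster of `b` in `G − W` meets `T`. -/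
noncomputable def kappa (W : Set V) : R := delClusterProb p ends b {S' | ∃ t ∈ T, t ∈ S'} W

omit [Fintype E] [DecidableEq E] [Fintype V] [DecidableEq V] in
/-- `{C(b) meets T} = {b ∈ K}`. -/
lemma clusterInEvent_meets_eq :
    clusterInEvent ends b {S' | ∃ t ∈ T, t ∈ S'} = hitsK ends T {b} := by
  ext ω
  simp only [clusterInEvent, Set.mem_setOf_eq, mem_cluster, hitsK_singleton]
  constructor
  · rintro ⟨t, ht, hc⟩; exact ⟨t, ht, conn_symm hc⟩
  · rintro ⟨t, ht, hc⟩; exact ⟨t, ht, conn_symm hc⟩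

omit [DecidableEq V] [LinearOrder R] [IsStrictOrderedRing R] in
/-- The S-frame tower identity: for a family `𝓤` of vertex sets,
`P(C(s) ∈ 𝓤, b ∈ K, b ∉ C(s)) = E[1_𝓤(C(s)) · κ_b(C(s)) · 1{b ∉ C(s)}]`. -/
lemma sframe_tower (𝓤 : Set (Set V)) :
    prob p (clusterSetInEvent ends {s} 𝓤 ∩ hitsK ends T {b} ∩ avoidAllT ends {s} {b}) =
      expect p (fun ω => 𝓤.indicator 1 (cluster ends ω s) * kappa p ends T b (cluster ends ω s) *
        (avoidAllT ends {s} {b}).indicator 1 ω) := by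
  rw [← clusterInEvent_meets_eq, prob_clusterSetIn_inter_eq_expect p ends {s} b 𝓤]
  congr 1
  funext ω
  rw [clusterSet_singleton]
  rfl

omit [Fintype V] [DecidableEq V] in
/-- `κ_b` is antitone. -/
lemma kappa_anti (hp : IsProbVec p) : Antitone (kappa p ends T b) :=
  delClusterProb_anti p hp ends b (fun _ _ h ⟨t, ht, htW⟩ => ⟨t, ht, h htW⟩)

omit [Fintype V] [DecidableEq V] in
/-- `κ_b ≤ 1`. -/
lemma kappa_le_one (hp : IsProbVec p) (W : Set V) : kappa p ends T b W ≤ 1 :=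
  delClusterProb_le_one p hp ends b _ W

omit [Fintype E] [DecidableEq E] [Fintype V] [DecidableEq V] in
/-- Membership atoms: `{a ∈ C(s)}`. -/
lemma mem_connAll_singleton_iff (ω : Config E) :
    ω ∈ connAll ends s {a} ↔ a ∈ cluster ends ω s := by
  simp [connAll, mem_cluster]

omit [Fintype E] [DecidableEq E] [Fintype V] in
/-- Membership atoms: `C(s) avoids T ∪ A`. -/
lemma forall_notMem_cluster_iff (ω : Config E) :
    (∀ v ∈ T ∪ A, v ∉ cluster ends ω s) ↔ ω ∈ avoidAll ends s (T ∪ A) := by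
  simp [avoidAll, mem_cluster]

omit [Fintype E] [DecidableEq E] [Fintype V] in
/-- Membership atoms: `R_{T ∪ A ∪ {b}} = R_{T ∪ A} ∩ {b ∉ C(s)}`. -/
lemma mem_avoid_union_singleton_iff (ω : Config E) :
    ω ∈ avoidAll ends s (T ∪ A ∪ {b}) ↔
      ω ∈ avoidAll ends s (T ∪ A) ∧ ω ∈ avoidAllT ends {s} {b} := by
  rw [avoidAll_union_eq ends s (T ∪ A) {b}, avoidAllT_seed_singleton, Set.mem_inter_iff]

omit [Fintype E] [DecidableEq E] [Fintype V] [LinearOrder R] [IsStrictOrderedRing R] in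
/-- Pointwise: `1[a ∈ S] · 1_{R₁} = 1_{X ∩ R₁}`. -/
lemma pt_one (ω : Config E) :
    (if a ∈ cluster ends ω s then (1 : R) else 0) *
        (avoidAll ends s (T ∪ A ∪ {b})).indicator (1 : Config E → R) ω =
      (connAll ends s {a} ∩ avoidAll ends s (T ∪ A ∪ {b})).indicator (1 : Config E → R) ω := by
  simp only [Set.indicator_apply, Pi.one_apply, Set.mem_inter_iff, mem_connAll_singleton_iff]
  split_ifs <;> simp_all

omit [Fintype E] [DecidableEq E] [Fintype V] [LinearOrder R] [IsStrictOrderedRing R] in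
/-- Pointwise: `1_{𝓤₀}(S) · κ_b(S) · 1{b ∉ S} = κ_b(S) · 1_{R₁}` for `𝓤₀ = {W | W avoids T ∪ A}`. -/
lemma pt_two (κ : Set V → R) (ω : Config E) :
    ({W : Set V | ∀ v ∈ T ∪ A, v ∉ W}).indicator (1 : Set V → R) (cluster ends ω s) *
        κ (cluster ends ω s) * (avoidAllT ends {s} {b}).indicator (1 : Config E → R) ω =
      κ (cluster ends ω s) * (avoidAll ends s (T ∪ A ∪ {b})).indicator (1 : Config E → R) ω := by
  simp only [Set.indicator_apply, Pi.one_apply, Set.mem_setOf_eq, forall_notMem_cluster_iff,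
    mem_avoid_union_singleton_iff]
  split_ifs <;> simp_all

omit [Fintype E] [DecidableEq E] [Fintype V] [LinearOrder R] [IsStrictOrderedRing R] in
/-- Pointwise: `1_{𝓤₁}(S) · κ_b(S) · 1{b ∉ S} = 1[a ∈ S] · κ_b(S) · 1_{R₁}` for
`𝓤₁ = {W | a ∈ W ∧ W avoids T ∪ A}`. -/
lemma pt_three (κ : Set V → R) (ω : Config E) :
    ({W : Set V | a ∈ W ∧ ∀ v ∈ T ∪ A, v ∉ W}).indicator (1 : Set V → R) (cluster ends ω s) *
        κ (cluster ends ω s) * (avoidAllT ends {s} {b}).indicator (1 : Config E → R) ω =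
      (if a ∈ cluster ends ω s then (1 : R) else 0) * κ (cluster ends ω s) *
        (avoidAll ends s (T ∪ A ∪ {b})).indicator (1 : Config E → R) ω := by
  simp only [Set.indicator_apply, Pi.one_apply, Set.mem_setOf_eq, forall_notMem_cluster_iff,
    mem_avoid_union_singleton_iff]
  split_ifs <;> simp_all

omit [Fintype E] [DecidableEq E] [Fintype V] in
/-- The event of the tower identity for `𝓤₀`. -/
lemma tower_event_zero :
    clusterSetInEvent ends {s} {W : Set V | ∀ v ∈ T ∪ A, v ∉ W} ∩ hitsK ends T {b} ∩
        avoidAllT ends {s} {b} = hitsK ends T {b} ∩ avoidAll ends s (T ∪ A ∪ {b}) := by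
  ext ω
  simp only [Set.mem_inter_iff, clusterSetInEvent, clusterSet_singleton, Set.mem_setOf_eq,
    forall_notMem_cluster_iff, mem_avoid_union_singleton_iff]
  tauto

omit [Fintype E] [DecidableEq E] [Fintype V] in
/-- The event of the tower identity for `𝓤₁`. -/
lemma tower_event_one :
    clusterSetInEvent ends {s} {W : Set V | a ∈ W ∧ ∀ v ∈ T ∪ A, v ∉ W} ∩ hitsK ends T {b} ∩
        avoidAllT ends {s} {b} =
      connAll ends s {a} ∩ hitsK ends T {b} ∩ avoidAll ends s (T ∪ A ∪ {b}) := by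
  ext ω
  simp only [Set.mem_inter_iff, clusterSetInEvent, clusterSet_singleton, Set.mem_setOf_eq,
    forall_notMem_cluster_iff, mem_avoid_union_singleton_iff, mem_connAll_singleton_iff]
  tauto

/-- **The S-frame BHK step** (given `R₁ = R_{T ∪ A ∪ {b}}`): `X = {a ∈ S}` and `{b ∈ K}` are
negatively correlated — `P(X, b ∈ K; R₁) · P(R₁) ≤ P(X; R₁) · P(b ∈ K; R₁)`. -/
theorem sframe_step (hp : IsProbVec p) :
    prob p (connAll ends s {a} ∩ hitsK ends T {b} ∩ avoidAll ends s (T ∪ A ∪ {b})) *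
        prob p (avoidAll ends s (T ∪ A ∪ {b})) ≤
      prob p (connAll ends s {a} ∩ avoidAll ends s (T ∪ A ∪ {b})) *
        prob p (hitsK ends T {b} ∩ avoidAll ends s (T ∪ A ∪ {b})) := by
  -- the functionals of `S = C(s)`: `F₁ = 1[a ∈ W]`, `F₂ = 1 − κ_b(W)`
  have hF₁ : Monotone (fun W : Set V => if a ∈ W then (1 : R) else 0) := by
    intro W W' h
    simp only
    split_ifs with h1 h2
    · exact le_rfl
    · exact absurd (h h1) h2
    · exact zero_le_one
    · exact le_rfl
  have hF₂ : Monotone (fun W => 1 - kappa p ends T b W) := by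
    intro W W' h
    simp only
    linarith [kappa_anti p ends T b hp h]
  have key := bhk_multi p hp ends {s} hF₁ hF₂
    (fun W => by show (0 : R) ≤ if a ∈ W then 1 else 0; split_ifs <;> simp)
    (fun W => sub_nonneg.2 (kappa_le_one p ends T b hp W)) (T ∪ A ∪ {b}) (T ∪ A ∪ {b})
  rw [Finset.inter_self, Finset.union_self, avoidAllT_seed_singleton] at key
  simp only [Pi.mul_apply, clusterSet_singleton] at key
  -- `e1`: `E[1[a ∈ S] 1_{R₁}] = P(X; R₁)`
  have e1 : expect p (fun ω => (if a ∈ cluster ends ω s then (1 : R) else 0) *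
      (avoidAll ends s (T ∪ A ∪ {b})).indicator 1 ω) =
      prob p (connAll ends s {a} ∩ avoidAll ends s (T ∪ A ∪ {b})) := by
    rw [prob_eq_expect_indicator]
    congr 1
    funext ω
    exact pt_one ends s T A a b ω
  -- `E[κ_b(S) 1_{R₁}] = P(b ∈ K; R₁)` and `E[1[a ∈ S] κ_b(S) 1_{R₁}] = P(X, b ∈ K; R₁)`
  have t0 : expect p (fun ω => kappa p ends T b (cluster ends ω s) *
      (avoidAll ends s (T ∪ A ∪ {b})).indicator 1 ω) =
      prob p (hitsK ends T {b} ∩ avoidAll ends s (T ∪ A ∪ {b})) := by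
    rw [← tower_event_zero ends s T A b, sframe_tower]
    congr 1
    funext ω
    exact (pt_two ends s T A b (kappa p ends T b) ω).symm
  have t1 : expect p (fun ω => (if a ∈ cluster ends ω s then (1 : R) else 0) *
      kappa p ends T b (cluster ends ω s) * (avoidAll ends s (T ∪ A ∪ {b})).indicator 1 ω) =
      prob p (connAll ends s {a} ∩ hitsK ends T {b} ∩ avoidAll ends s (T ∪ A ∪ {b})) := by
    rw [← tower_event_one ends s T A a b, sframe_tower]
    congr 1
    funext ω
    exact (pt_three ends s T A a b (kappa p ends T b) ω).symm
  -- `e2`, `e3` by linearity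
  have e2 : expect p (fun ω => (1 - kappa p ends T b (cluster ends ω s)) *
      (avoidAll ends s (T ∪ A ∪ {b})).indicator 1 ω) =
      prob p (avoidAll ends s (T ∪ A ∪ {b})) -
        prob p (hitsK ends T {b} ∩ avoidAll ends s (T ∪ A ∪ {b})) := by
    rw [← t0, prob_eq_expect_indicator, ← expect_sub]
    congr 1
    funext ω
    simp only [Pi.sub_apply]
    ring
  have e3 : expect p (fun ω => (if a ∈ cluster ends ω s then (1 : R) else 0) *
      (1 - kappa p ends T b (cluster ends ω s)) * (avoidAll ends s (T ∪ A ∪ {b})).indicator 1 ω) =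
      prob p (connAll ends s {a} ∩ avoidAll ends s (T ∪ A ∪ {b})) -
        prob p (connAll ends s {a} ∩ hitsK ends T {b} ∩ avoidAll ends s (T ∪ A ∪ {b})) := by
    rw [← t1, ← e1, ← expect_sub]
    congr 1
    funext ω
    simp only [Pi.sub_apply]
    ring
  rw [e1, e2, e3] at key
  nlinarith [key]

end SFrame

end Gate

end Summit.Ventures.PercRepro2
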